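import Summits.AtomisticToContinuum.Crystallization.Theorems.ChartedZeroExcessLayeredLatticeLiouvilleZZE
import Summits.AtomisticToContinuum.Crystallization.Theorems.ChartedZeroExcessLayeredLatticeLiouvilleZZ

/-!
# Part ZZF «ConePins — FOUR transfer» (lens-2 g80; (B′.2) of the REACH DESIGN, critic rows 1445 (D) / 1447 (B)(3))

The cone pin at a shallow zone site `x` (memo `g80/memo/Bprime-reach.md` §3) constrains the partner index `g x` by the relations of
`x` to its PINNED two-shell members: ADJACENCY for first-shell members (transported along partners by ZZ `barlowAdj_partner`) and the
SECOND-SHELL relation for second-shell members.  This rider types the second-shell relation on the index side and transports it: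

* §0 the `9/16` first-shell member lemma `member_cone_first_nine` (threshold trade-off of row 1445 (D)(i): `9/16` keeps «≥ 3 members,
  ≤ 1 competitor, BAD 0» in all 8 letter contexts and on the fine scan, cone margin `0.998·(9/16) − 0.0633·0.8269 − ½ = 0.0090`
  instead of `0.0018`; ZZE's `5/9` lemma stays available).
* §1 PATTERN COMBINATORICS (`decide` on the integer models, then scaling): every second-shell vector `v` (`‖v‖ = √2`) of either two-shell
  pattern has (at least) FOUR first-shell vectors `u` with `‖u‖ = 1`, `dist v u = 1` — the square of the octahedron opposite to `v`
  (`exists_four_common_of_twoShellPattern`).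
* §2 the PHYSICAL relation `BondFour Y q y` («`q ≠ y`, no bond, ≥ 4 common bonded neighbours in `Y`») and ★ `bondFour_of_twoShellGood`: at a
  point `q` of a `ϑ`-two-shell-good set (`0 ≤ ϑ`, `aHi(1 + 2ϑ) ≤ 28/25`; the window forces `ϑ < 1/2`) every `y ∈ Y` in the DISTANCE WINDOW
  `max(28/25, aHi(1+ϑ)) < dist y q ≤ (3/2)·aLo` is a second-shell site and `BondFour Y q y` holds (coverage clause ⇒ pattern site;
  first shell excluded by `dist > aHi(1+ϑ)`; the four pattern neighbours are bonded to both by the triangle inequality).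
* §3 the INDEX relation `BarlowFour τ x y` («`x ≠ y`, `¬ BarlowAdj`, ≥ 4 common `BarlowAdj`-neighbours»; numerically — all 8 letter contexts —
  the non-adjacent pairs with ≥ 4 common neighbours are EXACTLY the six `√2` pairs, next best 3 at `1.633a`; the index-side proof of that
  characterisation belongs to the pin tables (B′.3)) and its transport through a Barlow bond chart whose domain covers the bonds at `Φ x`
  (`barlowFour_of_bondFour`).
* §4 ★ PARTNER TRANSFER `barlowFour_partner` (the ZZ setting: `ε`-partners `Ψ z ↔ Φ (g z)`; C two-shell good at `Φ (g z)` with tolerance `ϑ`):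
  an S-pair at physical distance in `[lo, hi]` with `aHi(1+ϑ) + 2ε < lo`, `28/25 + 2ε < lo`, `hi + 2ε ≤ (3/2)·aLo` has `BarlowFour τ' (g z) (g z')`;
  the S-side window of a second-shell member (`dist_window_of_secondShell`: `aLoS(√2 − θ) ≤ dist ≤ aHiS(√2 + θ)`).
* §5 RECORD NUMEROLOGY `four_window_record` (θ = 1/16, S-scale ∈ [9/10, 1], ε = 10⁻⁴; C-dials to be delivered by LEMMA C: tolerance
  `ϑC ≤ 10⁻³`, scale `aC ∈ [99/100, 107/100]` — hard core `1 − 2ε` below, S-bond ceiling `17/16 + 2ε` above): first-shell exclusion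
  `1.0713 < 1.2165`, bond ceiling `1.1202 < 1.2165`, coverage `1.4769 ≤ 1.485`, common-neighbour bonds `1.0722 ≤ 28/25`.  The `1.633a` class never
  enters: it lies beyond the coverage radius `3a/2` of `IsTwoShellGoodSet`, so the discrimination is coverage + first-shell exclusion.

0 sorry; standard axioms.  Next: (B′.3) pin tables by `decide` (first-shell threshold `9/16`, second `11/20`), (B′.4) LEMMA Θ, (B′.5) assembly.
-/

noncomputable section
open scoped BigOperators Classical InnerProductSpace RealInnerProductSpace
open MeasureTheory Set Metric Filter Topology
open Summit.AtomisticToContinuum.Crystallization.Theorems.ChartedPlanarOrderRigidityDoor (E3 IsClean IsCharted)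
open Literature.Geometry.DiscreteGeometry (IsTwoShellGoodSet intVec intVec_apply intVec_sub intVec_injective norm_intVec sqNormInt
  scaledPattern scaledPattern_map_injective norm_eq_one_of_mem_scaledPattern fccInt hcpInt fccSecondShellInt hcpSecondShellInt
  sqNormInt_fccInt sqNormInt_hcpInt fccTwoShellPattern hcpTwoShellPattern norm_of_mem_fccTwoShellPattern norm_of_mem_hcpTwoShellPattern)

namespace Summit.AtomisticToContinuum.Crystallization.Theorems.ChartedZeroExcessLayeredLatticeLiouville

/-! ### §0  The `9/16` first-shell member lemma -/

section Metric
variable {V : Type*} [NormedAddCommGroup V] [InnerProductSpace ℝ V]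

/-- ★ **FIRST-SHELL MEMBER at threshold `9/16`** (pattern angle `≤ arccos (9/16) ≈ 55.77°`): an atom within `a/16` of `p + U`, `‖U‖ = a`,
`⟪U, w⟫ ≥ (9/16)‖U‖‖w‖`, lies in the physical `60°`-cone of `w`.  Constants `c₁ = 0.998`, `s₁ = 0.0633`, `c₂ = 9/16`, `s₂ = 0.8269`
(`(9/16)² + s₂² = 1.00017 ≥ 1`): `c₁c₂ − s₁s₂ = 0.5090 ≥ ½` (margin `0.0090`, vs `0.0018` at `5/9`). [this file, g80] -/
theorem member_cone_first_nine {p n U w : V} {a : ℝ} (ha : 0 < a) (hU : ‖U‖ = a) (hn : dist n (p + U) ≤ 1 / 16 * a)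
    (hw : 9 / 16 * (‖U‖ * ‖w‖) ≤ ⟪U, w⟫_ℝ) : 1 / 2 * (‖n - p‖ * ‖w‖) ≤ ⟪n - p, w⟫_ℝ := by
  have hU0 : U ≠ 0 := by rw [← norm_pos_iff, hU]; exact ha
  have hb : ‖(n - p) - U‖ ≤ 1 / 16 * a := by rw [sub_sub, ← dist_eq_norm]; exact hn
  have h := inner_ge_of_near_of_toward (c₁ := 998 / 1000) (s₁ := 633 / 10000) (c₂ := 9 / 16) (s₂ := 8269 / 10000) hU0 hb
    (by norm_num) (by norm_num) (by norm_num) (by norm_num) (by rw [hU]; nlinarith [sq_nonneg a]) (by norm_num) (by norm_num) hw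
  have h0 : 0 ≤ ‖n - p‖ * ‖w‖ := by positivity
  linarith [mul_le_mul_of_nonneg_right (show (1 : ℝ) / 2 ≤ 998 / 1000 * (9 / 16) - 633 / 10000 * (8269 / 10000) by norm_num) h0]

end Metric

/-! ### §1  Pattern combinatorics: the four common neighbours of a second-shell vector -/

/-- fcc: every second-shell vector `(±2,0,0)…` of `D₃` has at least four minimal vectors at squared distance `2` (the square
`(1,±1,0), (1,0,±1)` for `(2,0,0)`). [folklore; `decide`] -/
theorem four_le_card_common_fccInt :
    ∀ v ∈ fccSecondShellInt, 4 ≤ (fccInt.filter fun u => sqNormInt (v - u) = ((2 : ℕ) : ℤ)).card := by decide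

/-- hcp (integer model at scale `3√2`): every second-shell vector has at least four first-shell vectors at squared distance `18`.
[folklore; `decide`] -/
theorem four_le_card_common_hcpInt :
    ∀ v ∈ hcpSecondShellInt, 4 ≤ (hcpInt.filter fun u => sqNormInt (v - u) = ((18 : ℕ) : ℤ)).card := by decide

/-- the scaled form of §1: in `scaledPattern S₂ N`, every vector has ≥ 4 points of `scaledPattern S₁ N` (unit vectors) at distance `1`,
given the integer count. [formal bookkeeping] -/
theorem exists_four_common_scaled {S₁ S₂ : Finset (Fin 3 → ℤ)} {N : ℕ} (hN : N ≠ 0) (h1 : ∀ u ∈ S₁, sqNormInt u = N)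
    (h4 : ∀ v ∈ S₂, 4 ≤ (S₁.filter fun u => sqNormInt (v - u) = (N : ℤ)).card) {v : E3} (hv : v ∈ scaledPattern S₂ N) :
    ∃ T : Finset E3, T ⊆ scaledPattern S₁ N ∧ 4 ≤ T.card ∧ ∀ u ∈ T, ‖u‖ = 1 ∧ dist v u = 1 := by
  obtain ⟨vI, hvI, rfl⟩ := Finset.mem_image.1 hv
  refine ⟨(S₁.filter fun u => sqNormInt (vI - u) = (N : ℤ)).image fun u => (Real.sqrt N)⁻¹ • intVec u, ?_, ?_, ?_⟩
  · intro x hx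
    obtain ⟨uI, huI, rfl⟩ := Finset.mem_image.1 hx
    exact Finset.mem_image.2 ⟨uI, (Finset.mem_filter.1 huI).1, rfl⟩
  · rw [Finset.card_image_of_injective _ (scaledPattern_map_injective hN)]
    exact h4 vI hvI
  · intro x hx
    obtain ⟨uI, huI, rfl⟩ := Finset.mem_image.1 hx
    obtain ⟨huS, hd⟩ := Finset.mem_filter.1 huI
    refine ⟨norm_eq_one_of_mem_scaledPattern hN h1 (Finset.mem_image.2 ⟨uI, huS, rfl⟩), ?_⟩
    rw [dist_scaled_intVec hN, hd, Int.cast_natCast, div_self (by exact_mod_cast hN), Real.sqrt_one]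

/-- a scaled pattern of a union is the union of the scaled patterns. [formal bookkeeping] -/
private theorem scaledPattern_union (S₁ S₂ : Finset (Fin 3 → ℤ)) (N : ℕ) :
    scaledPattern (S₁ ∪ S₂) N = scaledPattern S₁ N ∪ scaledPattern S₂ N :=
  Finset.image_union _ _

/-- ★ **FOUR COMMON NEIGHBOURS**: every second-shell vector (`‖v‖ = √2`) of the fcc or hcp two-shell pattern has at least four pattern
vectors of norm `1` at distance `1` from it. [folklore: the octahedral square opposite to a second neighbour; HalesDSP2012 §1.3] -/
theorem exists_four_common_of_twoShellPattern {P : Finset E3} (hP : P = fccTwoShellPattern ∨ P = hcpTwoShellPattern) {v : E3}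
    (hv : v ∈ P) (h2 : ‖v‖ = Real.sqrt 2) :
    ∃ T : Finset E3, T ⊆ P ∧ 4 ≤ T.card ∧ ∀ u ∈ T, ‖u‖ = 1 ∧ dist v u = 1 := by
  have h21 : Real.sqrt 2 ≠ 1 := fun h => by
    have h' := Real.sqrt_eq_one.1 h
    norm_num at h'
  rcases hP with rfl | rfl
  · have hv' : v ∈ scaledPattern fccSecondShellInt 2 := by
      have hu := hv
      rw [fccTwoShellPattern, scaledPattern_union, Finset.mem_union] at hu
      rcases hu with h | h
      · exact absurd ((norm_eq_one_of_mem_scaledPattern two_ne_zero sqNormInt_fccInt h).symm.trans h2).symm h21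
      · exact h
    obtain ⟨T, hT, h4, hTu⟩ := exists_four_common_scaled two_ne_zero sqNormInt_fccInt four_le_card_common_fccInt hv'
    refine ⟨T, fun x hx => ?_, h4, hTu⟩
    rw [fccTwoShellPattern, scaledPattern_union, Finset.mem_union]
    exact Or.inl (hT hx)
  · have hv' : v ∈ scaledPattern hcpSecondShellInt 18 := by
      have hu := hv
      rw [hcpTwoShellPattern, scaledPattern_union, Finset.mem_union] at hu
      rcases hu with h | h
      · exact absurd ((norm_eq_one_of_mem_scaledPattern (by norm_num) sqNormInt_hcpInt h).symm.trans h2).symm h21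
      · exact h
    obtain ⟨T, hT, h4, hTu⟩ := exists_four_common_scaled (by norm_num) sqNormInt_hcpInt four_le_card_common_hcpInt hv'
    refine ⟨T, fun x hx => ?_, h4, hTu⟩
    rw [hcpTwoShellPattern, scaledPattern_union, Finset.mem_union]
    exact Or.inl (hT hx)

/-! ### §2  The physical FOUR relation from small-tolerance two-shell goodness -/

/-- **BondFour** (physical second-shell relation): `q ≠ y`, no bond between them, and at least four atoms of `Y` bonded to both.
[this file, g80] -/
def BondFour (Y : Set E3) (q y : E3) : Prop :=
  q ≠ y ∧ ¬ IsBond q y ∧ ∃ T : Finset E3, 4 ≤ T.card ∧ ∀ n ∈ T, n ∈ Y ∧ IsBond q n ∧ IsBond y n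

/-- distance of a matched site from the centre: `|dist (f v) q − a‖v‖| ≤ ϑa`. [formal bookkeeping] -/
theorem dist_matched_le {q m v : E3} {a ϑ : ℝ} {A : E3 →ₗᵢ[ℝ] E3} (ha : 0 ≤ a) (hm : dist m (q + a • A v) ≤ ϑ * a) :
    dist m q ≤ a * ‖v‖ + ϑ * a ∧ a * ‖v‖ ≤ dist m q + ϑ * a := by
  have hAv : dist (q + a • A v) q = a * ‖v‖ := by
    rw [dist_eq_norm, add_sub_cancel_left, norm_smul, Real.norm_of_nonneg ha, A.norm_map]
  constructor
  · linarith [dist_triangle m (q + a • A v) q]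
  · have := dist_triangle (q + a • A v) m q
    rw [dist_comm (q + a • A v) m] at this
    linarith

/-- distance between two matched sites: `|dist (f v) (f u) − a·dist v u| ≤ 2ϑa`. [formal bookkeeping] -/
theorem dist_matched_matched {q m m' v u : E3} {a ϑ : ℝ} {A : E3 →ₗᵢ[ℝ] E3} (ha : 0 ≤ a) (hm : dist m (q + a • A v) ≤ ϑ * a)
    (hm' : dist m' (q + a • A u) ≤ ϑ * a) :
    dist m m' ≤ a * dist v u + 2 * (ϑ * a) ∧ a * dist v u ≤ dist m m' + 2 * (ϑ * a) := by
  have hvu : dist (q + a • A v) (q + a • A u) = a * dist v u := by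
    rw [dist_eq_norm, add_sub_add_left_eq_sub, ← smul_sub, ← map_sub, norm_smul, Real.norm_of_nonneg ha, A.norm_map, dist_eq_norm]
  constructor
  · have := dist_triangle4 m (q + a • A v) (q + a • A u) m'
    rw [dist_comm (q + a • A u) m'] at this
    linarith
  · have := dist_triangle4 (q + a • A v) m m' (q + a • A u)
    rw [dist_comm (q + a • A v) m] at this
    linarith

/-- ★ **BondFour FROM TWO-SHELL GOODNESS**: at a `ϑ`-good point `q` (`0 ≤ ϑ`, `0 < aLo`, `aHi(1+2ϑ) ≤ 28/25`; the window below forces `ϑ < 1/2`), every `y ∈ Y` with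
`aHi(1+ϑ) < dist y q`, `28/25 < dist y q`, `dist y q ≤ (3/2)·aLo` satisfies `BondFour Y q y`: by coverage `y = f v` is a pattern site, the first
shell is excluded by `dist > a(1+ϑ)`, so `‖v‖ = √2`, and the four pattern neighbours of `v` (§1) are atoms bonded to `q` (`dist ∈ [a(1−ϑ), a(1+ϑ)]`)
and to `y` (`dist ∈ [a(1−2ϑ), a(1+2ϑ)]`). [this file, g80] -/
theorem bondFour_of_twoShellGood {ϑ aLo aHi : ℝ} {Y : Set E3} {q y : E3} (hgood : IsTwoShellGoodSet ϑ aLo aHi Y q)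
    (hϑ : 0 ≤ ϑ) (haLo : 0 < aLo) (hbond : aHi * (1 + 2 * ϑ) ≤ 28 / 25) (hy : y ∈ Y)
    (hlo : aHi * (1 + ϑ) < dist y q) (hlo' : 28 / 25 < dist y q) (hhi : dist y q ≤ 3 / 2 * aLo) : BondFour Y q y := by
  obtain ⟨a, haLo', haHi, A, P, f, hP, hf, hinj, hcov⟩ := hgood
  have ha : 0 < a := lt_of_lt_of_le haLo haLo'
  have hyq : y ≠ q := by
    intro h; rw [h, dist_self] at hlo'; norm_num at hlo'
  obtain ⟨v, hvP, hfv⟩ := hcov y hy hyq (by nlinarith)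
  have hmv := (hf v hvP).2
  have hnv : ‖v‖ = 1 ∨ ‖v‖ = Real.sqrt 2 := by
    rcases hP with rfl | rfl
    · exact norm_of_mem_fccTwoShellPattern hvP
    · exact norm_of_mem_hcpTwoShellPattern hvP
  have h2 : ‖v‖ = Real.sqrt 2 := by
    rcases hnv with h1 | h
    · exfalso
      have hup := (dist_matched_le ha.le hmv).1
      rw [hfv, h1, mul_one] at hup
      nlinarith
    · exact h
  obtain ⟨T₀, hT₀P, h4, hT₀⟩ := exists_four_common_of_twoShellPattern hP hvP h2
  refine ⟨Ne.symm hyq, fun hb => ?_, T₀.image f, ?_, ?_⟩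
  · have := hb.2
    rw [dist_comm] at this
    linarith
  · rw [Finset.card_image_of_injOn (hinj.mono (by exact_mod_cast hT₀P))]
    exact h4
  · intro n hn
    obtain ⟨u, huT, rfl⟩ := Finset.mem_image.1 hn
    have huP : u ∈ P := hT₀P huT
    obtain ⟨hu1, hvu⟩ := hT₀ u huT
    have hmu := (hf u huP).2
    obtain ⟨hup, hdown⟩ := dist_matched_le ha.le hmu
    obtain ⟨hup', hdown'⟩ := dist_matched_matched ha.le hmv hmu
    rw [hu1, mul_one] at hup hdown
    rw [hvu, mul_one, hfv] at hup' hdown'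
    have haHi' : a * (1 + 2 * ϑ) ≤ aHi * (1 + 2 * ϑ) := mul_le_mul_of_nonneg_right haHi (by linarith)
    refine ⟨(hf u huP).1, ⟨?_, ?_⟩, ⟨?_, ?_⟩⟩
    · rw [dist_comm]; nlinarith
    · rw [dist_comm]; nlinarith
    · nlinarith
    · nlinarith

/-! ### §3  The index FOUR relation and its transport through a bond chart -/

/-- **BarlowFour** (index second-shell relation in the Barlow model with letters `τ`): `x ≠ y`, not adjacent, and at least four common
`BarlowAdj`-neighbours.  (In fcc and hcp alike these are exactly the six octahedron-opposite pairs at `√2·a`; next best is 3 common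
neighbours at `1.633a` — the characterisation is proved index-side in (B′.3).) [this file, g80] -/
def BarlowFour (τ : ℤ → Bool) (x y : ℤ × ℤ × ℤ) : Prop :=
  x ≠ y ∧ ¬ BarlowAdj τ x y ∧ ∃ T : Finset (ℤ × ℤ × ℤ), 4 ≤ T.card ∧ ∀ z ∈ T, BarlowAdj τ x z ∧ BarlowAdj τ y z

/-- ★ **chart transport**: a Barlow bond chart `Φ` on `D` turns `BondFour C (Φ x) (Φ y)` into `BarlowFour τ' x y`, provided the bonds at
`Φ x` are charted (`every atom of C bonded to Φ x is some Φ z, z ∈ D`). [this file, g80] -/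
theorem barlowFour_of_bondFour {C : Set E3} {D : Set (ℤ × ℤ × ℤ)} {Φ : ℤ × ℤ × ℤ → E3} {τ' : ℤ → Bool}
    (hΦ : IsBarlowBondChart C D Φ τ') {x y : ℤ × ℤ × ℤ} (hx : x ∈ D) (hy : y ∈ D) (hfour : BondFour C (Φ x) (Φ y))
    (hcov : ∀ n ∈ C, IsBond (Φ x) n → ∃ z ∈ D, Φ z = n) : BarlowFour τ' x y := by
  obtain ⟨hne, hnb, T, hT, hTp⟩ := hfour
  have hσ : ∀ n ∈ T, ∃ z ∈ D, Φ z = n := fun n hn => hcov n (hTp n hn).1 (hTp n hn).2.1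
  choose! σ hσD hσΦ using hσ
  refine ⟨fun h => hne (by rw [h]), fun h => hnb ((hΦ.2.2 x hx y hy).2 h), T.image σ, ?_, ?_⟩
  · rw [Finset.card_image_of_injOn]
    · exact hT
    · intro n hn n' hn' h
      have e := congrArg Φ h
      rwa [hσΦ n (by exact_mod_cast hn), hσΦ n' (by exact_mod_cast hn')] at e
  · intro z hz
    obtain ⟨n, hn, rfl⟩ := Finset.mem_image.1 hz
    obtain ⟨-, hqn, hyn⟩ := hTp n hn
    refine ⟨(hΦ.2.2 x hx (σ n) (hσD n hn)).1 ?_, (hΦ.2.2 y hy (σ n) (hσD n hn)).1 ?_⟩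
    · rw [hσΦ n hn]; exact hqn
    · rw [hσΦ n hn]; exact hyn

/-! ### §4  Transfer along partners -/

/-- ★★ **PARTNER TRANSFER OF THE SECOND-SHELL RELATION** (the ZZ setting): `Ψ z`, `Ψ z'` have `ε`-partners `Φ (g z)`, `Φ (g z')` in the
charted set `C` (Barlow bond chart `Φ, τ'` on `D ∋ g z, g z'`, bonds at `Φ (g z)` charted), `C` is `ϑ`-two-shell good at `Φ (g z)`
(`0 ≤ ϑ`, `0 < aLo`, `aHi(1+2ϑ) ≤ 28/25`), and the S-distance lies in a window `[lo, hi]` with `aHi(1+ϑ) + 2ε < lo`, `28/25 + 2ε < lo`,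
`hi + 2ε ≤ (3/2)aLo`.  Then `BarlowFour τ' (g z) (g z')`. [this file, g80] -/
theorem barlowFour_partner {C : Set E3} {D : Set (ℤ × ℤ × ℤ)} {Ψ Φ : ℤ × ℤ × ℤ → E3} {τ' : ℤ → Bool}
    {g : ℤ × ℤ × ℤ → ℤ × ℤ × ℤ} {ε ϑ aLo aHi lo hi : ℝ} (hΦ : IsBarlowBondChart C D Φ τ') {z z' : ℤ × ℤ × ℤ}
    (hz : g z ∈ D) (hz' : g z' ∈ D) (hd : dist (Ψ z) (Φ (g z)) ≤ ε) (hd' : dist (Ψ z') (Φ (g z')) ≤ ε)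
    (hgood : IsTwoShellGoodSet ϑ aLo aHi C (Φ (g z))) (hϑ : 0 ≤ ϑ) (haLo : 0 < aLo)
    (hbond : aHi * (1 + 2 * ϑ) ≤ 28 / 25) (hcov : ∀ n ∈ C, IsBond (Φ (g z)) n → ∃ y ∈ D, Φ y = n)
    (hwlo : lo ≤ dist (Ψ z) (Ψ z')) (hwhi : dist (Ψ z) (Ψ z') ≤ hi)
    (hlo : aHi * (1 + ϑ) + 2 * ε < lo) (hlo' : 28 / 25 + 2 * ε < lo) (hhi : hi + 2 * ε ≤ 3 / 2 * aLo) :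
    BarlowFour τ' (g z) (g z') := by
  have hup := dist_le_of_partners hd hd'
  have hdown := dist_ge_of_partners hd hd'
  refine barlowFour_of_bondFour hΦ hz hz' ?_ hcov
  refine bondFour_of_twoShellGood hgood hϑ haLo hbond (hΦ.2.1 hz') ?_ ?_ ?_
  · rw [dist_comm]; linarith
  · rw [dist_comm]; linarith
  · rw [dist_comm]; linarith

/-- the S-side window of a SECOND-SHELL MEMBER: a site matched within `θa` to `p + a•A v`, `‖v‖ = √2`, `a ∈ [aLo, aHi]`, `0 ≤ θ ≤ 1`, lies at distance
`∈ [aLo(√2 − θ), aHi(√2 + θ)]` from `p`. [formal bookkeeping] -/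
theorem dist_window_of_secondShell {p m v : E3} {a aLo aHi θ : ℝ} {A : E3 →ₗᵢ[ℝ] E3} (haLo : 0 ≤ aLo) (ha : aLo ≤ a) (ha' : a ≤ aHi)
    (hθ0 : 0 ≤ θ) (hθ : θ ≤ 1) (hv : ‖v‖ = Real.sqrt 2) (hm : dist m (p + a • A v) ≤ θ * a) :
    aLo * (Real.sqrt 2 - θ) ≤ dist p m ∧ dist p m ≤ aHi * (Real.sqrt 2 + θ) := by
  have h1 : (1 : ℝ) ≤ Real.sqrt 2 := Real.one_le_sqrt.mpr (by norm_num)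
  obtain ⟨hup, hdown⟩ := dist_matched_le (haLo.trans ha) hm
  rw [hv, dist_comm] at hup hdown
  constructor
  · nlinarith [mul_le_mul_of_nonneg_right ha (show (0 : ℝ) ≤ Real.sqrt 2 - θ by linarith)]
  · nlinarith [mul_le_mul_of_nonneg_right ha' (show (0 : ℝ) ≤ Real.sqrt 2 + θ by linarith)]

/-! ### §5  Record numerology of the window -/

/-- `1.4142 < √2 < 1.41422`. [formal bookkeeping] -/
theorem sqrt_two_bounds : (14142 : ℝ) / 10000 < Real.sqrt 2 ∧ Real.sqrt 2 < 141422 / 100000 := by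
  constructor
  · rw [Real.lt_sqrt (by norm_num)]; norm_num
  · rw [Real.sqrt_lt' (by norm_num)]; norm_num

/-- **RECORD WINDOW** (critic row 1447 (B)(3): «print the inequality with the record ε»).  S-side: θ = 1/16, scale `aS ∈ [9/10, 1]`, so a
second-shell member sits at `dist ∈ [(9/10)(√2 − 1/16), √2 + 1/16] = [1.2165, 1.4767]`; partners move it by `≤ 2ε = 2·10⁻⁴`.  C-side dials
(LEMMA C): tolerance `ϑC ≤ 10⁻³`, scale `aC ∈ [99/100, 107/100]`.  The four inequalities of `barlowFour_partner` with `lo, hi` the S-window: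
first-shell exclusion `aC(1+ϑC) + 2ε < lo`, bond ceiling `28/25 + 2ε < lo`, coverage `hi + 2ε ≤ (3/2)aC_lo`, neighbour bonds `aC(1+2ϑC) ≤ 28/25`.
[this file, g80] -/
theorem four_window_record (aC ϑC : ℝ) (haC : 99 / 100 ≤ aC) (haC' : aC ≤ 107 / 100) (hϑC : ϑC ≤ 1 / 1000) :
    aC * (1 + ϑC) + 2 * (1 / 10000) < 9 / 10 * (Real.sqrt 2 - 1 / 16) ∧
    (28 : ℝ) / 25 + 2 * (1 / 10000) < 9 / 10 * (Real.sqrt 2 - 1 / 16) ∧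
    (1 : ℝ) * (Real.sqrt 2 + 1 / 16) + 2 * (1 / 10000) ≤ 3 / 2 * (99 / 100) ∧
    aC * (1 + 2 * ϑC) ≤ 28 / 25 := by
  obtain ⟨hl, hu⟩ := sqrt_two_bounds
  refine ⟨by nlinarith, by linarith, by linarith, by nlinarith⟩

end Summit.AtomisticToContinuum.Crystallization.Theorems.ChartedZeroExcessLayeredLatticeLiouville

end
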